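import Summits.CriticalPhenomena.PercolationContinuityZ3.Theorems.PercNearOneGluingNoHeavyLowerTailSahiGridPatternSeparatedGood

/-!
# `NoHeavyLowerTail` (crux stmt-CriticalPhenomena-4575), Sahi programme P1: **`GOOD × GOOD ⇒ GOOD` FOR `(x∨y) × V` AGAINST THE PRODUCT TEST SET `(x∨y) × A₀`
# AND AN ARBITRARY UP-SET `Q`**, and at the separated pairs with `Q ⊆ {y ≥ 1}` (every `k`; goodness of `V` at section rectangles, Harris, monotonicity)

Support file (Sahi cell, seat `prim-sahi-p1`, generation 45; `--supports stmt-CriticalPhenomena-4575`).  Pure proofs, no definitions, no `sorry`, standard axioms.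
Vocabulary of `…SahiGridPattern{,CellForm,CoCountProductNProduct,CoCountProductNOrTwo,SeparatedGood}` (`Pd`, `glue`, `sect`, `ind`, `sStarD`, `thetaVal`, `lamU`).

THE MATHEMATICS (seat memo FROM-prim-sahi-p1-gen45, §2).  `S = x∨y ⊆ [3]²`, `V ⊆ [3]^k` an up-set, `A = S × V`; the first test set is the PRODUCT `P = S × A₀`
(same outer block, any inner up-set `A₀`), the second test set `Q ⊆ [3]^{2+k}` is an ARBITRARY up-set with its nine sections `Q^σ` (nested along the cell order).
With the section expansion `sStarD_blockAnd_sections` and the formal LP of the seat code (`famLP2.py P00`) one finds the certificate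
  `sStarD A P Q = 4[Φ(Q^{01})+Φ(Q^{02})+Φ(Q^{10})+Φ(Q^{20})] + 2[Φ(Q^{11})+Φ(Q^{12})+Φ(Q^{21})+Φ(Q^{22})]`
  `                + Σ_{σ ∈ {11,12,21,22}} [h_V(A₀,Q^σ) + h_V(Q^σ,A₀) + H-type slack] + 4 h-type slack at Q^{00}`
  `                + 2^k·[4(n₀₁−n₀₀) + 2(n₀₂−n₀₁) + 2(n₁₁−n₀₁) + 2(n₁₂−n₀₂) + (n₂₁−n₁₁) + (n₂₂−n₁₂)] + 4 μ_V(A₀, Q^{00})`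
(`Φ(Y) = Φ_V(A₀,Y)` goodness slacks, `n_σ = #(A₀ ∩ Q^σ ∩ V)` nondecreasing along the cell order, `μ_V ≥ 0` a Latin count), every bracket `≥ 0`.
**THEOREM `sStarD_blockAnd_orTwo_prodTest_nonneg` (every `k`).**  For up-sets `V` (good), `A₀` and ANY up-set `Q`: `0 ≤ sStarD ((x∨y)×V) ((x∨y)×A₀) Q`.
So the triple (product block, product test set over the same outer block, arbitrary test set) is settled for `x∨y` from black-box goodness of `V`; the seat's
formal LP says the same is NOT available for the cylinder `P = [3]² × A₀` (memo §2).  HONEST LABEL: `PatternPos d` (`d ≥ 4`), Conjecture A and `T×` in general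
remain OPEN; nothing here asserts them.  The last section is the mirror `Q ⊆ {y≥1}` (`B₀ = ∅`, `A₀ ⊆ A₁ ⊆ A₂`) of the separated family of
`…SeparatedGood` (`sStarD_blockAnd_orTwo_sepY_nonneg`, certificate `Σ_j[4Φ(A₀,B_j)+2N(B_j;A₀∩V)] + Σ_{i,j≥1}[3Φ+h+h]`). [this work]
-/

namespace Summit.CriticalPhenomena.PercolationContinuityZ3.Theorems.SahiGridPattern

open Finset SahiGrid3
open scoped BigOperators

/-! ### `P = S × A₀` against an ARBITRARY up-set `Q` -/

section ProductTest

variable {k : ℕ} {S : Finset (Pd (1 + 1))} {V : Finset (Pd k)} {A : Finset (Pd ((1 + 1) + k))}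

/-- Monotonicity of the diagonal count `2^d·#(X ∩ Y ∩ U)` in `Y` (stated with the factor `2^d` for `linarith`). [this work] -/
theorem diagSum_mono {d : ℕ} (X U : Finset (Pd d)) {Y Y' : Finset (Pd d)} (h : Y ⊆ Y') :
    (2:ℤ) ^ d * (∑ q : Pd d, ind X q * ind Y q * ind U q) ≤ (2:ℤ) ^ d * ∑ q : Pd d, ind X q * ind Y' q * ind U q := by
  refine mul_le_mul_of_nonneg_left (Finset.sum_le_sum fun q _ => ?_) (pow_nonneg (by norm_num) d)
  refine mul_le_mul_of_nonneg_right (mul_le_mul_of_nonneg_left ?_ (ind_nonneg' X q)) (ind_nonneg' U q)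
  unfold ind
  by_cases hq : q ∈ Y
  · rw [if_pos hq, if_pos (h hq)]
  · rw [if_neg hq]; split_ifs <;> norm_num

/-- The nine outer cells of `[3]²` in glued form and their order relations used below. [this work] -/
theorem cell_le_facts :
    (glue (fun _ => (0:Fin 3)) (fun _ => (0:Fin 3)) : Pd (1 + 1)) ≤ glue (fun _ => (0:Fin 3)) (fun _ => (1:Fin 3)) ∧
    (glue (fun _ => (0:Fin 3)) (fun _ => (1:Fin 3)) : Pd (1 + 1)) ≤ glue (fun _ => (0:Fin 3)) (fun _ => (2:Fin 3)) ∧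
    (glue (fun _ => (0:Fin 3)) (fun _ => (1:Fin 3)) : Pd (1 + 1)) ≤ glue (fun _ => (1:Fin 3)) (fun _ => (1:Fin 3)) ∧
    (glue (fun _ => (0:Fin 3)) (fun _ => (2:Fin 3)) : Pd (1 + 1)) ≤ glue (fun _ => (1:Fin 3)) (fun _ => (2:Fin 3)) ∧
    (glue (fun _ => (1:Fin 3)) (fun _ => (1:Fin 3)) : Pd (1 + 1)) ≤ glue (fun _ => (2:Fin 3)) (fun _ => (1:Fin 3)) ∧
    (glue (fun _ => (1:Fin 3)) (fun _ => (2:Fin 3)) : Pd (1 + 1)) ≤ glue (fun _ => (2:Fin 3)) (fun _ => (2:Fin 3)) ∧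
    (glue (fun _ => (0:Fin 3)) (fun _ => (0:Fin 3)) : Pd (1 + 1)) ≤ glue (fun _ => (1:Fin 3)) (fun _ => (0:Fin 3)) ∧
    (glue (fun _ => (1:Fin 3)) (fun _ => (0:Fin 3)) : Pd (1 + 1)) ≤ glue (fun _ => (2:Fin 3)) (fun _ => (0:Fin 3)) ∧
    (glue (fun _ => (1:Fin 3)) (fun _ => (0:Fin 3)) : Pd (1 + 1)) ≤ glue (fun _ => (1:Fin 3)) (fun _ => (1:Fin 3)) ∧
    (glue (fun _ => (2:Fin 3)) (fun _ => (0:Fin 3)) : Pd (1 + 1)) ≤ glue (fun _ => (2:Fin 3)) (fun _ => (1:Fin 3)) ∧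
    (glue (fun _ => (1:Fin 3)) (fun _ => (1:Fin 3)) : Pd (1 + 1)) ≤ glue (fun _ => (1:Fin 3)) (fun _ => (2:Fin 3)) ∧
    (glue (fun _ => (2:Fin 3)) (fun _ => (1:Fin 3)) : Pd (1 + 1)) ≤ glue (fun _ => (2:Fin 3)) (fun _ => (2:Fin 3)) := by
  have f01 : ((fun _ => (0:Fin 3)) : Pd 1) ≤ fun _ => 1 := fun _ => show (0:Fin 3) ≤ 1 by decide
  have f12 : ((fun _ => (1:Fin 3)) : Pd 1) ≤ fun _ => 2 := fun _ => show (1:Fin 3) ≤ 2 by decide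
  exact ⟨glue_le_glue_iff.2 ⟨le_rfl, f01⟩, glue_le_glue_iff.2 ⟨le_rfl, f12⟩, glue_le_glue_iff.2 ⟨f01, le_rfl⟩,
    glue_le_glue_iff.2 ⟨f01, le_rfl⟩, glue_le_glue_iff.2 ⟨f12, le_rfl⟩, glue_le_glue_iff.2 ⟨f12, le_rfl⟩,
    glue_le_glue_iff.2 ⟨f01, le_rfl⟩, glue_le_glue_iff.2 ⟨f12, le_rfl⟩, glue_le_glue_iff.2 ⟨le_rfl, f01⟩,
    glue_le_glue_iff.2 ⟨le_rfl, f01⟩, glue_le_glue_iff.2 ⟨le_rfl, f12⟩, glue_le_glue_iff.2 ⟨le_rfl, f12⟩⟩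

/-- **THEOREM (`good × good ⇒ good` for `(x∨y) × V` against the product test set `(x∨y) × A₀` and an ARBITRARY up-set `Q`; every `k`).**  `S = x∨y` (`hS`),
`A = S × V` (`hA`), `P = S × A₀` (`hP`), `Q ⊆ [3]^{2+k}` any up-set (`hQ`); `V, A₀` up-sets with `V` good (`hGV`, bilinear form at all up-set rectangles — only the
eight section rectangles `(A₀, Q^σ)`, `σ ≠ (0,0)`, are used).  Then `0 ≤ sStarD A P Q`.  Certificate (formal LP, seat code `famLP2.py P00`):
`4[Φ(Q^{01})+Φ(Q^{02})+Φ(Q^{10})+Φ(Q^{20})] + 2[Φ(Q^{11})+Φ(Q^{12})+Φ(Q^{21})+Φ(Q^{22})] + Harris slacks + diagonal monotonicity along Q^{00} ⊆ Q^{01} ⊆ …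
+ 4μ_V(A₀,Q^{00})` (`Φ(Y) = Φ_V(A₀,Y)`). [this work] -/
theorem sStarD_blockAnd_orTwo_prodTest_nonneg (hS : ∀ ξ η : Pd 1, glue ξ η ∈ S ↔ (1 ≤ ξ 0 ∨ 1 ≤ η 0))
    (hV : IsUpperSet (V : Set (Pd k))) (hA : ∀ σ z, glue σ z ∈ A ↔ (σ ∈ S ∧ z ∈ V))
    (hGV : ∀ X X' : Finset (Pd k), IsUpperSet (X : Set (Pd k)) → IsUpperSet (X' : Set (Pd k)) →
      (∑ q ∈ X, ∑ r ∈ X', thetaVal V q r) ≤ ∑ q ∈ X ∩ X', lamU V q)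
    {A0 : Finset (Pd k)} (hA0 : IsUpperSet (A0 : Set (Pd k)))
    {P Q : Finset (Pd ((1 + 1) + k))} (hP : ∀ σ q, glue σ q ∈ P ↔ (σ ∈ S ∧ q ∈ A0)) (hQ : IsUpperSet (Q : Set (Pd ((1 + 1) + k)))) :
    0 ≤ sStarD A P Q := by
  obtain ⟨h00, h11, h22, h01, h02, h10, h12, h20, h21, t01, t02, t10, t12, t20, t21⟩ := pd1_facts
  obtain ⟨u00, u01, u02, u10, u11, u12, u20, u21, u22⟩ := ind_orTwo_vals hS
  obtain ⟨l1, l2, l3, l4, l5, l6, l7, l8, l9, l10, l11, l12⟩ := cell_le_facts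
  -- the nine sections of `Q` are up-sets, nested along the cell order
  have hup : ∀ σ : Pd (1 + 1), IsUpperSet ((sect Q σ : Finset (Pd k)) : Set (Pd k)) := fun σ => isUpperSet_sect hQ σ
  -- goodness at the nine rectangles `(A₀, Q^σ)` in counts
  have g := fun σ : Pd (1 + 1) => good_rect_counts (hGV A0 (sect Q σ) hA0 (hup σ))
  have g00 := g (glue (fun _ => 0) (fun _ => 0)); have g01 := g (glue (fun _ => 0) (fun _ => 1)); have g02 := g (glue (fun _ => 0) (fun _ => 2))
  have g10 := g (glue (fun _ => 1) (fun _ => 0)); have g11 := g (glue (fun _ => 1) (fun _ => 1)); have g12 := g (glue (fun _ => 1) (fun _ => 2))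
  have g20 := g (glue (fun _ => 2) (fun _ => 0)); have g21 := g (glue (fun _ => 2) (fun _ => 1)); have g22 := g (glue (fun _ => 2) (fun _ => 2))
  -- coefficientwise Harris, three forms, nine cells
  have a := fun σ : Pd (1 + 1) => pairCount_le_harris hV hA0 (hup σ)
  have b := fun σ : Pd (1 + 1) => pairCount_le_harris' hV hA0 (hup σ)
  have c := fun σ : Pd (1 + 1) => diagCount_le_harris hV hA0 (hup σ)
  have a00 := a (glue (fun _ => 0) (fun _ => 0)); have a01 := a (glue (fun _ => 0) (fun _ => 1)); have a02 := a (glue (fun _ => 0) (fun _ => 2))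
  have a10 := a (glue (fun _ => 1) (fun _ => 0)); have a11 := a (glue (fun _ => 1) (fun _ => 1)); have a12 := a (glue (fun _ => 1) (fun _ => 2))
  have a20 := a (glue (fun _ => 2) (fun _ => 0)); have a21 := a (glue (fun _ => 2) (fun _ => 1)); have a22 := a (glue (fun _ => 2) (fun _ => 2))
  have b00 := b (glue (fun _ => 0) (fun _ => 0)); have b01 := b (glue (fun _ => 0) (fun _ => 1)); have b02 := b (glue (fun _ => 0) (fun _ => 2))
  have b10 := b (glue (fun _ => 1) (fun _ => 0)); have b11 := b (glue (fun _ => 1) (fun _ => 1)); have b12 := b (glue (fun _ => 1) (fun _ => 2))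
  have b20 := b (glue (fun _ => 2) (fun _ => 0)); have b21 := b (glue (fun _ => 2) (fun _ => 1)); have b22 := b (glue (fun _ => 2) (fun _ => 2))
  have c00 := c (glue (fun _ => 0) (fun _ => 0)); have c01 := c (glue (fun _ => 0) (fun _ => 1)); have c02 := c (glue (fun _ => 0) (fun _ => 2))
  have c10 := c (glue (fun _ => 1) (fun _ => 0)); have c11 := c (glue (fun _ => 1) (fun _ => 1)); have c12 := c (glue (fun _ => 1) (fun _ => 2))
  have c20 := c (glue (fun _ => 2) (fun _ => 0)); have c21 := c (glue (fun _ => 2) (fun _ => 1)); have c22 := c (glue (fun _ => 2) (fun _ => 2))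
  -- monotonicity of the diagonal count along the cell order
  have d := fun (σ τ : Pd (1 + 1)) (h : σ ≤ τ) => diagSum_mono A0 V (sect_mono (k := k) hQ h)
  have d1 := d _ _ l1; have d2 := d _ _ l2; have d3 := d _ _ l3; have d4 := d _ _ l4; have d5 := d _ _ l5; have d6 := d _ _ l6
  have d7 := d _ _ l7; have d8 := d _ _ l8; have d9 := d _ _ l9; have d10 := d _ _ l10; have d11 := d _ _ l11; have d12 := d _ _ l12
  -- the leftover Latin count at the corner is nonnegative
  have m00 : 0 ≤ ∑ q : Pd k, ∑ r : Pd k, ind A0 q * ind (sect Q (glue (fun _ => (0:Fin 3)) (fun _ => (0:Fin 3)))) r *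
      (if TotDist q r = true then (1:ℤ) else 0) * ind V (thirdPt q r) :=
    Finset.sum_nonneg fun q _ => Finset.sum_nonneg fun r _ =>
      mul_nonneg (mul_nonneg (mul_nonneg (ind_nonneg' A0 q) (ind_nonneg' _ r)) (by split_ifs <;> norm_num)) (ind_nonneg' V _)
  -- expand
  rw [sStarD_blockAnd_sections hA P Q]
  simp only [ind_glue_product hP]
  simp only [← ind_sect (B := Q)]
  simp only [sum_glue (n := 1) (k := 1), sum_pd1, ite_totDist_glue, thirdPt_glue,
    h00, h11, h22, h01, h02, h10, h12, h20, h21, t01, t02, t10, t12, t20, t21,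
    u00, u01, u02, u10, u11, u12, u20, u21, u22,
    Bool.false_eq_true, if_false, if_true, zero_mul, mul_zero, mul_one, one_mul, zero_add, add_zero, zero_sub, sub_zero,
    Finset.sum_const_zero]
  simp only [pairCount_swap (sect Q _), diagCount_swap]
  linarith [g00, g01, g02, g10, g11, g12, g20, g21, g22, a00, a01, a02, a10, a11, a12, a20, a21, a22,
    b00, b01, b02, b10, b11, b12, b20, b21, b22, c00, c01, c02, c10, c11, c12, c20, c21, c22,
    d1, d2, d3, d4, d5, d6, d7, d8, d9, d10, d11, d12, m00]

end ProductTest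

/-! ### The separated family with `Q ⊆ {y ≥ 1}` (mirror of `…SeparatedGood`) -/

section SepY

variable {k : ℕ} {S : Finset (Pd (1 + 1))} {V : Finset (Pd k)} {A : Finset (Pd ((1 + 1) + k))}

/-- Section values of `P` (`P^{(i,·)} = A_i`, `A₀ ⊆ A₁ ⊆ A₂`) and `Q` (`Q^{(·,j)} = ∅, B₁, B₂`) on the nine outer cells. [this work] -/
theorem ind_sepY_vals {A0 A1 A2 B1 B2 : Finset (Pd k)} {P Q : Finset (Pd ((1 + 1) + k))} (hA01 : A0 ⊆ A1) (hA12 : A1 ⊆ A2) (hB12 : B1 ⊆ B2)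
    (hP : ∀ ξ η q, glue (glue ξ η) q ∈ P ↔ (q ∈ A0 ∨ (1 ≤ ξ 0 ∧ q ∈ A1) ∨ (ξ 0 = 2 ∧ q ∈ A2)))
    (hQ : ∀ ξ η q, glue (glue ξ η) q ∈ Q ↔ ((1 ≤ η 0 ∧ q ∈ B1) ∨ (η 0 = 2 ∧ q ∈ B2))) :
    (∀ (η : Pd 1) (q : Pd k), ind P (glue (glue (fun _ => (0:Fin 3)) η) q) = ind A0 q) ∧
    (∀ (η : Pd 1) (q : Pd k), ind P (glue (glue (fun _ => (1:Fin 3)) η) q) = ind A1 q) ∧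
    (∀ (η : Pd 1) (q : Pd k), ind P (glue (glue (fun _ => (2:Fin 3)) η) q) = ind A2 q) ∧
    (∀ (ξ : Pd 1) (q : Pd k), ind Q (glue (glue ξ (fun _ => (0:Fin 3))) q) = 0) ∧
    (∀ (ξ : Pd 1) (q : Pd k), ind Q (glue (glue ξ (fun _ => (1:Fin 3))) q) = ind B1 q) ∧
    (∀ (ξ : Pd 1) (q : Pd k), ind Q (glue (glue ξ (fun _ => (2:Fin 3))) q) = ind B2 q) := by
  have f11 : (1:Fin 3) ≤ 1 := le_rfl
  have f12 : (1:Fin 3) ≤ 2 := by decide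
  have f10 : ¬ (1:Fin 3) ≤ 0 := by decide
  have f02 : ¬ (0:Fin 3) = 2 := by decide
  have f12' : ¬ (1:Fin 3) = 2 := by decide
  refine ⟨?_, ?_, ?_, ?_, ?_, ?_⟩
  · intro η q; unfold ind
    simp only [hP, f10, f02, false_and, or_false]
  · intro η q; unfold ind
    simp only [hP, f11, f12', true_and, false_and, or_false]
    by_cases h0 : q ∈ A0
    · rw [if_pos (Or.inl h0), if_pos (hA01 h0)]
    · by_cases h1 : q ∈ A1
      · rw [if_pos (Or.inr h1), if_pos h1]
      · rw [if_neg, if_neg h1]; rintro (h | h) <;> contradiction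
  · intro η q; unfold ind
    simp only [hP, f12, true_and]
    by_cases h0 : q ∈ A0
    · rw [if_pos (Or.inl h0), if_pos (hA12 (hA01 h0))]
    · by_cases h1 : q ∈ A1
      · rw [if_pos (Or.inr (Or.inl h1)), if_pos (hA12 h1)]
      · by_cases h2 : q ∈ A2
        · rw [if_pos (Or.inr (Or.inr h2)), if_pos h2]
        · rw [if_neg, if_neg h2]; rintro (h | h | h) <;> contradiction
  · intro ξ q; unfold ind; simp only [hQ, f10, f02, false_and, or_self, if_false]
  · intro ξ q; unfold ind; simp only [hQ, f11, f12', true_and, false_and, or_false]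
  · intro ξ q; unfold ind
    simp only [hQ, f12, true_and]
    by_cases h1 : q ∈ B1
    · rw [if_pos (Or.inl h1), if_pos (hB12 h1)]
    · by_cases h2 : q ∈ B2
      · rw [if_pos (Or.inr h2), if_pos h2]
      · rw [if_neg, if_neg h2]; rintro (h | h) <;> contradiction

/-- **THEOREM (`good × good ⇒ good` for `(x∨y) × V` at every separated test pair with `Q ⊆ {y ≥ 1}`; every `k`).**  `S = x∨y` (`hS`), `A = S × V` (`hA`);
inner up-sets `A₀ ⊆ A₁ ⊆ A₂`, `B₁ ⊆ B₂` and `V`; `P^{(i,j)} = A_i` (`hP`), `Q^{(i,j)} = (∅, B₁, B₂)_j` (`hQ`).  If `V` is good at the six section rectangles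
`(A_i, B_j)`, `j ≥ 1` (`hG01 … hG22`), then `0 ≤ sStarD A P Q`.  Certificate: `Σ_j [4Φ(A₀,B_j) + 2N(B_j;A₀∩V)] + Σ_{i,j≥1} [3Φ(A_i,B_j) + h_V(A_i,B_j) + h_V(B_j,A_i)]`. [this work] -/
theorem sStarD_blockAnd_orTwo_sepY_nonneg (hS : ∀ ξ η : Pd 1, glue ξ η ∈ S ↔ (1 ≤ ξ 0 ∨ 1 ≤ η 0))
    (hV : IsUpperSet (V : Set (Pd k))) (hA : ∀ σ z, glue σ z ∈ A ↔ (σ ∈ S ∧ z ∈ V))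
    {A0 A1 A2 B1 B2 : Finset (Pd k)} (hA0 : IsUpperSet (A0 : Set (Pd k))) (hA1 : IsUpperSet (A1 : Set (Pd k))) (hA2 : IsUpperSet (A2 : Set (Pd k)))
    (hB1 : IsUpperSet (B1 : Set (Pd k))) (hB2 : IsUpperSet (B2 : Set (Pd k)))
    (hA01 : A0 ⊆ A1) (hA12 : A1 ⊆ A2) (hB12 : B1 ⊆ B2)
    (hG01 : (∑ q ∈ A0, ∑ r ∈ B1, thetaVal V q r) ≤ ∑ q ∈ A0 ∩ B1, lamU V q)
    (hG02 : (∑ q ∈ A0, ∑ r ∈ B2, thetaVal V q r) ≤ ∑ q ∈ A0 ∩ B2, lamU V q)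
    (hG11 : (∑ q ∈ A1, ∑ r ∈ B1, thetaVal V q r) ≤ ∑ q ∈ A1 ∩ B1, lamU V q)
    (hG12 : (∑ q ∈ A1, ∑ r ∈ B2, thetaVal V q r) ≤ ∑ q ∈ A1 ∩ B2, lamU V q)
    (hG21 : (∑ q ∈ A2, ∑ r ∈ B1, thetaVal V q r) ≤ ∑ q ∈ A2 ∩ B1, lamU V q)
    (hG22 : (∑ q ∈ A2, ∑ r ∈ B2, thetaVal V q r) ≤ ∑ q ∈ A2 ∩ B2, lamU V q)
    {P Q : Finset (Pd ((1 + 1) + k))}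
    (hP : ∀ ξ η q, glue (glue ξ η) q ∈ P ↔ (q ∈ A0 ∨ (1 ≤ ξ 0 ∧ q ∈ A1) ∨ (ξ 0 = 2 ∧ q ∈ A2)))
    (hQ : ∀ ξ η q, glue (glue ξ η) q ∈ Q ↔ ((1 ≤ η 0 ∧ q ∈ B1) ∨ (η 0 = 2 ∧ q ∈ B2))) :
    0 ≤ sStarD A P Q := by
  obtain ⟨h00, h11, h22, h01, h02, h10, h12, h20, h21, t01, t02, t10, t12, t20, t21⟩ := pd1_facts
  obtain ⟨u00, u01, u02, u10, u11, u12, u20, u21, u22⟩ := ind_orTwo_vals hS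
  obtain ⟨p0, p1, p2, q0, q1, q2⟩ := ind_sepY_vals hA01 hA12 hB12 hP hQ
  have g01 := good_rect_counts hG01
  have g02 := good_rect_counts hG02
  have g11 := good_rect_counts hG11
  have g12 := good_rect_counts hG12
  have g21 := good_rect_counts hG21
  have g22 := good_rect_counts hG22
  have a01 := pairCount_le_harris hV hA0 hB1
  have a02 := pairCount_le_harris hV hA0 hB2
  have a11 := pairCount_le_harris hV hA1 hB1
  have a12 := pairCount_le_harris hV hA1 hB2
  have a21 := pairCount_le_harris hV hA2 hB1
  have a22 := pairCount_le_harris hV hA2 hB2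
  have b01 := pairCount_le_harris' hV hA0 hB1
  have b02 := pairCount_le_harris' hV hA0 hB2
  have b11 := pairCount_le_harris' hV hA1 hB1
  have b12 := pairCount_le_harris' hV hA1 hB2
  have b21 := pairCount_le_harris' hV hA2 hB1
  have b22 := pairCount_le_harris' hV hA2 hB2
  have c01 := diagCount_le_harris hV hA0 hB1
  have c02 := diagCount_le_harris hV hA0 hB2
  have c11 := diagCount_le_harris hV hA1 hB1
  have c12 := diagCount_le_harris hV hA1 hB2
  have c21 := diagCount_le_harris hV hA2 hB1
  have c22 := diagCount_le_harris hV hA2 hB2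
  have n01 : 0 ≤ ∑ q : Pd k, ∑ r : Pd k, ind A0 q * ind B1 r * (if TotDist q r = true then (1:ℤ) else 0) * ind V q :=
    Finset.sum_nonneg fun q _ => Finset.sum_nonneg fun r _ =>
      mul_nonneg (mul_nonneg (mul_nonneg (ind_nonneg' A0 q) (ind_nonneg' B1 r)) (by split_ifs <;> norm_num)) (ind_nonneg' V q)
  have n02 : 0 ≤ ∑ q : Pd k, ∑ r : Pd k, ind A0 q * ind B2 r * (if TotDist q r = true then (1:ℤ) else 0) * ind V q :=
    Finset.sum_nonneg fun q _ => Finset.sum_nonneg fun r _ =>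
      mul_nonneg (mul_nonneg (mul_nonneg (ind_nonneg' A0 q) (ind_nonneg' B2 r)) (by split_ifs <;> norm_num)) (ind_nonneg' V q)
  rw [sStarD_blockAnd_sections hA P Q]
  simp only [sum_glue (n := 1) (k := 1), sum_pd1, ite_totDist_glue, thirdPt_glue,
    h00, h11, h22, h01, h02, h10, h12, h20, h21, t01, t02, t10, t12, t20, t21,
    u00, u01, u02, u10, u11, u12, u20, u21, u22, p0, p1, p2, q0, q1, q2,
    Bool.false_eq_true, if_false, if_true, zero_mul, mul_zero, mul_one, one_mul, zero_add, add_zero, zero_sub, sub_zero,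
    Finset.sum_const_zero]
  simp only [pairCount_swap B1, pairCount_swap B2, diagCount_swap]
  linarith [g01, g02, g11, g12, g21, g22, a01, a02, a11, a12, a21, a22, b01, b02, b11, b12, b21, b22,
    c01, c02, c11, c12, c21, c22, n01, n02]

end SepY

end Summit.CriticalPhenomena.PercolationContinuityZ3.Theorems.SahiGridPattern
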